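import Summits.QuantumFields.YangMills.Theorems.UnitScaleTiltProp7SectET3CurvedPropagatorsT3
import HarnessLib

/-!
# Route `UnitScaleTilt`, crux K1 «MinimiserStabilityRegPr» (stmt-QuantumFields-19200) — route-R E′ (A′)-on-Σ, ★p1 g17 WORD 20 «COMB HILBERT LETTERS»:
# DEFINITIONS FILE — **THE COMB TWINS `QL2c QDc NSc Rc RcPi Qkc QadjPic laplaceAc PosOntoC GTc` OF BRICKS L0a §4 ∕ L0c ∕ L0d §1 WITH THE AVERAGING OF [Balaban1985Averaging]'s
# COMB `QTw := Prop7SymAvgTw.QTw` IN PLACE OF THE SYMMETRIC TUBE `QTwS`** — same weights `c₀ cB`, same carriers, same `DL2`∕`DstarL2`∕`adBg`, so every slot door instantiates by `rfl`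

Cell `ym3-torus`, width seat `ym3-torus-px6` g5 (★p1 g17 WORD 20 2026-08-29T03:07:30Z «px6 g5 = the comb letters file»).  `--kind definition --supports stmt-QuantumFields-19200 --as helper`;
count-neutral; review lane (definitions + `rfl`∕one-line glue only).  YM₃ on T³ is ladder rung R3, NOT d = 4, NOT the Clay problem; nothing here claims the stub, the crux or the gap.

WHY (★p1 WORD 20 + ★w2 (26)).  The (A′)-on-Σ growth lane is COMB end-to-end: its representatives come from `hThm2S` through ✓`exists_sigmaRep_of_thm2S` in the comb letters
(`AvgCondPrint ∧ IsLandauPrint`, chart `logChartTw`, averaging `QTw`), and on comb-Σ the `Q*aQ` penalty and the slice row are second order ONLY for the comb averaging and the comb projector.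
The S-letters of record (`QL2`, `RS`, `Qk`, `laplaceA` over `QTwS`) stay the EX CHART side's.  This file supplies the comb Hilbert letters so that ★p1's slots doors (over lit `laplaceAK`), w4 g8's
`coercive_…_of_normG₀` and px12's `bern_P` re-instantiate by `rfl` at `(Rr, Qc) := (Rc, Qkc)`.

THE PRINT.  [Balaban1985BackgroundPropagators] (3.14)–(3.15) p. 393 (the linear part `Q_j(U)` of the averaging; «the averaging operation used here is the operation U̿ʲ defined by the formulas
(89)–(92)» — the comb average of [Balaban1985Averaging]); (3.21)–(3.23) p. 394 (`R(U)` = the orthogonal projection onto `Δ^η_U N(Q′)`, `N(Q′) = {λ : Q′λ = 0}`); (3.26)–(3.27) p. 395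
(`Δ_a = Δ + DRD* + Q*aQ`, `G` its inverse); (3.115) p. 418 (`Q_jD = D_jQ′_j`); Thm 3.11 p. 416 (positivity on the regular class); [Balaban1985Variational] (44)–(46) p. 285.

WHAT IS DEFINED (member `F : T3Family`, heights `h : n ≤ K`, weights `c₀ cB` as in L0a, background `U₀`; `η = eta F n K = L^{−(K−n)}`):
* **`QL2c F n K h c₀ cB U₀ := toL2B ∘ QTw F n K h U₀ ∘ toL2⁻¹`** (print's comb `Q(U₀)` between the weighted `L²` spaces) and **`QadjPic := toL2⁻¹ ∘ (QL2c …)† ∘ toL2B`** (its adjoint read back);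
* **`QDc := QL2c ∘ DL2`**, **`NSc := ker QDc`** (the comb residual gauge algebra `N(Q′)` in the intrinsic form of ACK 32 (q1)), **`Rc := RLatticeK η⁻¹ (adBg U₀) (adBgInv U₀) (QDc U₀)`**
  (print's `R(U₀)` (3.21) for the comb averaging: the orthogonal projection onto `Δ^η_{U₀} N_c(U₀)`), **`RcPi := toL2S⁻¹ ∘ Rc ∘ toL2S`**;
* **`Qkc := η • QL2c`** (print's `Q_k(U₀)` in A-units), **`laplaceAc F n K h c₀ cB a Δx U₀ := laplaceALatticeK η⁻¹ (adBg U₀) (adBgInv U₀) (Δx U₀) (Rc U₀) (Qkc U₀) a`** (`Δ_a = Δx + D R_c D* + Q*aQ`),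
  **`PosOntoC`** (the class: `Δ_a` positive definite ∧ `Q_k` onto), **`GTc := if PosOntoC then G1LatticeK _ else 0`** (print's `G(U₀)` as a total letter).
* (v1.1) **`laplaceAcR … U₀ Rr`** — the same `Δ_a` with the gauge projector `Rr` a PARAMETER (★p1 g17 WORD 25 (b): slot of record `Rr := RcombL2`), `laplaceAcR_eq_laplaceAK` (rfl), `laplaceAc_eq_laplaceAcR` (rfl).
Glue (`rfl`∕one-liners): `QL2c_toL2`, `toL2_QadjPic`, `QadjPic_adjunction`, `QDc_apply`, `mem_NSc_iff`, `Rc_eq_projR`, `RcPi_apply`, `Rc_isSymmetric`, `Rc_Rc`, `exists_mem_NSc_Rc_eq`,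
`Rc_apply_covLapSite_of_mem`, `QL2c_DL2_eq_zero_of_mem_NSc`, ★`laplaceAc_eq_laplaceAK` (`rfl`, the shape of ✓`Prop7HessOnPrintSlice.laplaceA_eq_laplaceAK`), `GTc_of_pos`∕`GTc_of_not`, `laplaceAc_GTc`.
HONEST SCOPE.  Definitions; no estimate; positivity∕onto-ness are the class `PosOntoC`, not proved; `QTw`'s identification with print's comb average at `U₀ ≠ 1` is the lane's (J)-LOCATE, consumed by name.

References: T. Bałaban, CMP **99** (1985) 389–434 [Balaban1985BackgroundPropagators] ((3.14)–(3.16) p.393, (3.21)–(3.27) pp.394–395, (3.115) p.418, Thm 3.11 p.416, (3.122) p.420);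
CMP **102** (1985) 277–309 [Balaban1985Variational] ((44)–(46) p.285, (110) p.294); CMP **98** (1985) 17–51 [Balaban1985Averaging] ((89)–(92) p.31).
-/

set_option autoImplicit false

noncomputable section

open scoped InnerProductSpace ComplexConjugate Matrix.Norms.L2Operator BigOperators

namespace Summit.QuantumFields.YangMills.Theorems.Prop7SectET3CombLetters

open Literature.MathematicalPhysics.QuantumFieldTheory.Balaban1983to89
open Literature.MathematicalPhysics.QuantumFieldTheory.Balaban1983to89.T3ContinuumYM3Torus
open T3SectALandauChart (eta)
open B9SectCLatticeCarrier (Bond)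
open B9Eq311L2Pairing (WL2)
open B11Eq103H1Complex (SiteL2K BondL2K RLatticeK projR projR_isSymmetric exists_ker_projR_eq projR_apply_of_ker projR_projR laplaceALatticeK laplaceAK
  G1LatticeK laplaceALatticeK_G1LatticeK)
open Summit.QuantumFields.YangMills.Theorems.Prop7SectET3Transport (periodsT3)
open Summit.QuantumFields.YangMills.Theorems.Prop7SectET3HilbertLetters (W₂ adBg adBgInv toL2 toL2S toL2B DL2 DstarL2 covLapSite covLapSite_eq inner_toL2 inner_toL2B)
open Summit.QuantumFields.YangMills.Theorems.Prop7SymAvgTw (QTw)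

/-! ## §1 The comb averaging on `L²` and its adjoint read back (twin of brick L0a §4) -/

section Averaging

variable (F : T3Family) (n K : ℕ) (h : n ≤ K) (c₀ cB : ℝ)

/-- **PRINT'S COMB `Q(U₀)` BETWEEN THE HILBERT SPACES**: the comb averaging `Prop7SymAvgTw.QTw F n K h U₀` (the linear part of the twisted log-chart of [Balaban1985Averaging] (89)–(92),
(3.14)) conjugated by the `L²` transports of brick L0a. [cite: Balaban1985BackgroundPropagators, (3.14)–(3.15) p.393] -/
def QL2c (U₀ : GaugeField (F.P K) 0 (Matrix.specialUnitaryGroup (Fin 2) ℂ)) :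
    BondL2K ℂ 3 (periodsT3 F K) c₀ W₂ →ₗ[ℂ] WL2 ℂ (fun _ : PBond (F.P n) 0 => cB) W₂ :=
  (toL2B F n cB).toLinearMap ∘ₗ (QTw F n K h U₀).toLinearMap ∘ₗ (toL2 F K c₀).symm.toLinearMap

variable [Fact (0 < c₀)] [Fact (0 < cB)]

/-- **THE ADJOINT `Q*(U₀)` OF THE COMB AVERAGING READ BACK ON THE ROUTE CARRIERS**: `toL2⁻¹ ∘ (QL2c U₀)† ∘ toL2B` («adjoints … with respect to natural L² scalar products», p. 391).
[cite: Balaban1985BackgroundPropagators, p.391, (3.126) p.420] -/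
def QadjPic (U₀ : GaugeField (F.P K) 0 (Matrix.specialUnitaryGroup (Fin 2) ℂ)) :
    (PBond (F.P n) 0 → Matrix (Fin 2) (Fin 2) ℂ) →ₗ[ℂ] (PBond (F.P K) 0 → Matrix (Fin 2) (Fin 2) ℂ) :=
  (toL2 F K c₀).symm.toLinearMap ∘ₗ LinearMap.adjoint (QL2c F n K h c₀ cB U₀) ∘ₗ (toL2B F n cB).toLinearMap

variable {F n K h c₀ cB}

omit [Fact (0 < c₀)] [Fact (0 < cB)] in
/-- `QL2c U₀ (toL2 A) = toL2B (QTw U₀ A)`. [cite: Balaban1985BackgroundPropagators, (3.14) p.393] -/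
theorem QL2c_toL2 (U₀ : GaugeField (F.P K) 0 (Matrix.specialUnitaryGroup (Fin 2) ℂ)) (A : PBond (F.P K) 0 → Matrix (Fin 2) (Fin 2) ℂ) :
    QL2c F n K h c₀ cB U₀ (toL2 F K c₀ A) = toL2B F n cB (QTw F n K h U₀ A) := by
  simp [QL2c]

/-- `toL2 (QadjPic U₀ Y) = (QL2c U₀)† (toL2B Y)`. [cite: Balaban1985BackgroundPropagators, p.391] -/
theorem toL2_QadjPic (U₀ : GaugeField (F.P K) 0 (Matrix.specialUnitaryGroup (Fin 2) ℂ)) (Y : PBond (F.P n) 0 → Matrix (Fin 2) (Fin 2) ℂ) :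
    toL2 F K c₀ (QadjPic F n K h c₀ cB U₀ Y) = LinearMap.adjoint (QL2c F n K h c₀ cB U₀) (toL2B F n cB Y) := by
  simp [QadjPic]

/-- **THE ADJUNCTION FOR THE COMB AVERAGING ON THE ROUTE CARRIERS**: `cB·Σ_c tr((Q(U₀)A)(c)ᴴ Y(c)) = c₀·Σ_b tr(A(b)ᴴ (Q*(U₀)Y)(b))`.
[cite: Balaban1985BackgroundPropagators, p.391, (3.11) p.392, (3.16) p.393] -/
theorem QadjPic_adjunction (U₀ : GaugeField (F.P K) 0 (Matrix.specialUnitaryGroup (Fin 2) ℂ)) (A : PBond (F.P K) 0 → Matrix (Fin 2) (Fin 2) ℂ)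
    (Y : PBond (F.P n) 0 → Matrix (Fin 2) (Fin 2) ℂ) :
    (cB : ℂ) * ∑ c : PBond (F.P n) 0, Matrix.trace ((QTw F n K h U₀ A c).conjTranspose * Y c) =
      (c₀ : ℂ) * ∑ b : PBond (F.P K) 0, Matrix.trace ((A b).conjTranspose * QadjPic F n K h c₀ cB U₀ Y b) := by
  rw [← inner_toL2B (cB := cB), ← inner_toL2 (c₀ := c₀), ← QL2c_toL2, toL2_QadjPic, LinearMap.adjoint_inner_right]

end Averaging

/-! ## §2 The comb residual gauge algebra `N_c(U₀) = ker(Q∘D)` and print's projector `R(U₀)` for the comb averaging (twin of brick L0c) -/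

section Projector

variable (F : T3Family) (n K : ℕ) (h : n ≤ K) (c₀ cB : ℝ) [Fact (0 < c₀)]

/-- **THE LINEARISED COMB CONSTRAINT ON THE GAUGE DIRECTIONS, `λ ↦ Q(U₀)(D_{U₀}λ)`** ((3.114)–(3.115)). [cite: Balaban1985BackgroundPropagators, (3.114)–(3.115) p.418] -/
def QDc (U₀ : GaugeField (F.P K) 0 (Matrix.specialUnitaryGroup (Fin 2) ℂ)) : SiteL2K ℂ 3 (periodsT3 F K) c₀ W₂ →ₗ[ℂ] WL2 ℂ (fun _ : PBond (F.P n) 0 => cB) W₂ :=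
  QL2c F n K h c₀ cB U₀ ∘ₗ DL2 F n K c₀ U₀

/-- **THE COMB RESIDUAL GAUGE ALGEBRA `N_c(U₀) := ker (Q(U₀) ∘ D_{U₀})`** (print's `N(Q′)`, intrinsic form). [cite: Balaban1985BackgroundPropagators, (3.21) p.394, (3.115) p.418] -/
def NSc (U₀ : GaugeField (F.P K) 0 (Matrix.specialUnitaryGroup (Fin 2) ℂ)) : Submodule ℂ (SiteL2K ℂ 3 (periodsT3 F K) c₀ W₂) :=
  LinearMap.ker (QDc F n K h c₀ cB U₀)

/-- **PRINT'S GAUGE PROJECTOR `R(U₀)` (3.21) FOR THE COMB AVERAGING**: the orthogonal projection onto `Δ^η_{U₀} N_c(U₀)` in the weighted `L²` space of the gauge parameters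
(`B11Eq103H1Complex.RLatticeK` at the member's spacing, transporters and `Q′ := Q(U₀) ∘ D_{U₀}`). [cite: Balaban1985BackgroundPropagators, (3.20)–(3.23) p.394] -/
def Rc (U₀ : GaugeField (F.P K) 0 (Matrix.specialUnitaryGroup (Fin 2) ℂ)) : SiteL2K ℂ 3 (periodsT3 F K) c₀ W₂ →ₗ[ℂ] SiteL2K ℂ 3 (periodsT3 F K) c₀ W₂ :=
  RLatticeK (((eta F n K : ℝ) : ℂ)⁻¹) (adBg F K U₀) (adBgInv F K U₀) (QDc F n K h c₀ cB U₀)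

/-- **`R(U₀)` READ BACK ON THE ROUTE'S GAUGE PARAMETERS** `Site (F.P K) 0 → M₂(ℂ)`. [cite: Balaban1985BackgroundPropagators, (3.21) p.394] -/
def RcPi (U₀ : GaugeField (F.P K) 0 (Matrix.specialUnitaryGroup (Fin 2) ℂ)) : (Site (F.P K) 0 → Matrix (Fin 2) (Fin 2) ℂ) →ₗ[ℂ] (Site (F.P K) 0 → Matrix (Fin 2) (Fin 2) ℂ) :=
  (toL2S F K c₀).symm.toLinearMap ∘ₗ Rc F n K h c₀ cB U₀ ∘ₗ (toL2S F K c₀).toLinearMap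

variable {F n K h c₀ cB}

/-- Unfolding: `QDc U₀ λ = Q(U₀)(D_{U₀}λ)`. [cite: Balaban1985BackgroundPropagators, (3.115) p.418] -/
theorem QDc_apply (U₀ : GaugeField (F.P K) 0 (Matrix.specialUnitaryGroup (Fin 2) ℂ)) (l : SiteL2K ℂ 3 (periodsT3 F K) c₀ W₂) :
    QDc F n K h c₀ cB U₀ l = QL2c F n K h c₀ cB U₀ (DL2 F n K c₀ U₀ l) := rfl

/-- `λ ∈ N_c(U₀) ↔ Q(U₀)(D_{U₀}λ) = 0`. [cite: Balaban1985BackgroundPropagators, (3.21) p.394, (3.115) p.418] -/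
theorem mem_NSc_iff (U₀ : GaugeField (F.P K) 0 (Matrix.specialUnitaryGroup (Fin 2) ℂ)) (l : SiteL2K ℂ 3 (periodsT3 F K) c₀ W₂) :
    l ∈ NSc F n K h c₀ cB U₀ ↔ QL2c F n K h c₀ cB U₀ (DL2 F n K c₀ U₀ l) = 0 := LinearMap.mem_ker

/-- `Rc U₀` IS `B11Eq103H1Complex.projR` of the member's covariant site Laplacian and the comb linearised constraint. [cite: Balaban1985BackgroundPropagators, (3.21)–(3.23) p.394] -/
theorem Rc_eq_projR (U₀ : GaugeField (F.P K) 0 (Matrix.specialUnitaryGroup (Fin 2) ℂ)) :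
    Rc F n K h c₀ cB U₀ = projR (covLapSite F n K c₀ U₀) (QDc F n K h c₀ cB U₀) := by
  rw [Rc, RLatticeK, covLapSite_eq]

/-- Unfolding the readback of `Rc`. [cite: Balaban1985BackgroundPropagators, (3.21) p.394] -/
theorem RcPi_apply (U₀ : GaugeField (F.P K) 0 (Matrix.specialUnitaryGroup (Fin 2) ℂ)) (l : Site (F.P K) 0 → Matrix (Fin 2) (Fin 2) ℂ) :
    RcPi F n K h c₀ cB U₀ l = (toL2S F K c₀).symm (Rc F n K h c₀ cB U₀ (toL2S F K c₀ l)) := rfl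

/-- `Q(U₀)(D_{U₀}λ) = 0` for `λ ∈ N_c(U₀)` ((3.115) on the residual algebra, by construction). [cite: Balaban1985BackgroundPropagators, (3.115) p.418] -/
theorem QL2c_DL2_eq_zero_of_mem_NSc (U₀ : GaugeField (F.P K) 0 (Matrix.specialUnitaryGroup (Fin 2) ℂ)) {l : SiteL2K ℂ 3 (periodsT3 F K) c₀ W₂}
    (hl : l ∈ NSc F n K h c₀ cB U₀) : QL2c F n K h c₀ cB U₀ (DL2 F n K c₀ U₀ l) = 0 :=
  (mem_NSc_iff U₀ l).1 hl

/-- **`Rc` IS SYMMETRIC** («orthogonal projection»). [cite: Balaban1985BackgroundPropagators, (3.21) p.394] -/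
theorem Rc_isSymmetric (U₀ : GaugeField (F.P K) 0 (Matrix.specialUnitaryGroup (Fin 2) ℂ)) : (Rc F n K h c₀ cB U₀).IsSymmetric := by
  rw [Rc_eq_projR]
  exact projR_isSymmetric _ _

/-- **(3.22): `Rc f = Δ^η_{U₀}λ₀` FOR SOME `λ₀ ∈ N_c(U₀)`.** [cite: Balaban1985BackgroundPropagators, (3.22) p.394] -/
theorem exists_mem_NSc_Rc_eq (U₀ : GaugeField (F.P K) 0 (Matrix.specialUnitaryGroup (Fin 2) ℂ)) (f : SiteL2K ℂ 3 (periodsT3 F K) c₀ W₂) :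
    ∃ l ∈ NSc F n K h c₀ cB U₀, Rc F n K h c₀ cB U₀ f = covLapSite F n K c₀ U₀ l := by
  obtain ⟨l, hl, hf⟩ := exists_ker_projR_eq (covLapSite F n K c₀ U₀) (QDc F n K h c₀ cB U₀) f
  exact ⟨l, LinearMap.mem_ker.2 hl, by rw [Rc_eq_projR, hf]⟩

/-- **(3.21): `Rc` FIXES `Δ^η_{U₀}N_c(U₀)`.** [cite: Balaban1985BackgroundPropagators, (3.21) p.394] -/
theorem Rc_apply_covLapSite_of_mem (U₀ : GaugeField (F.P K) 0 (Matrix.specialUnitaryGroup (Fin 2) ℂ)) {l : SiteL2K ℂ 3 (periodsT3 F K) c₀ W₂}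
    (hl : l ∈ NSc F n K h c₀ cB U₀) : Rc F n K h c₀ cB U₀ (covLapSite F n K c₀ U₀ l) = covLapSite F n K c₀ U₀ l := by
  rw [Rc_eq_projR]
  exact projR_apply_of_ker _ _ (LinearMap.mem_ker.1 hl)

/-- **`Rc² = Rc`.** [cite: Balaban1985BackgroundPropagators, (3.21) p.394] -/
theorem Rc_Rc (U₀ : GaugeField (F.P K) 0 (Matrix.specialUnitaryGroup (Fin 2) ℂ)) (x : SiteL2K ℂ 3 (periodsT3 F K) c₀ W₂) :
    Rc F n K h c₀ cB U₀ (Rc F n K h c₀ cB U₀ x) = Rc F n K h c₀ cB U₀ x := by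
  rw [Rc_eq_projR]
  exact projR_projR _ _ x

end Projector

/-! ## §3 `Q_k` in A-units, `Δ_a`, the class `PosOntoC`, and the total letter `G` for the comb averaging (twin of brick L0d §1) -/

section Propagators

variable (F : T3Family) (n K : ℕ) (h : n ≤ K) (c₀ cB a : ℝ) [Fact (0 < c₀)] [Fact (0 < cB)]

/-- **PRINT'S COMB `Q_k(U₀)` IN A-UNITS**: `η • QL2c` (the chart letter lives in the exponent `X = ηA`; [Balaban1985Variational] (44) with `Lᵏη = 1`). [cite: Balaban1985Variational, (44)–(45) p.285] -/
def Qkc (U₀ : GaugeField (F.P K) 0 (Matrix.specialUnitaryGroup (Fin 2) ℂ)) : BondL2K ℂ 3 (periodsT3 F K) c₀ W₂ →ₗ[ℂ] WL2 ℂ (fun _ : PBond (F.P n) 0 => cB) W₂ :=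
  (((eta F n K : ℝ) : ℂ)) • QL2c F n K h c₀ cB U₀

variable (Δx : GaugeField (F.P K) 0 (Matrix.specialUnitaryGroup (Fin 2) ℂ) → (BondL2K ℂ 3 (periodsT3 F K) c₀ W₂ →ₗ[ℂ] BondL2K ℂ 3 (periodsT3 F K) c₀ W₂))

/-- **`Δ_a(U₀) = Δx(U₀) + D_{U₀} R_c(U₀) D*_{U₀} + Q*aQ` FOR THE COMB AVERAGING** ((3.26); generic in the Hessian slot `Δx`). [cite: Balaban1985BackgroundPropagators, (3.26) p.395, (3.122) p.420] -/
def laplaceAc (U₀ : GaugeField (F.P K) 0 (Matrix.specialUnitaryGroup (Fin 2) ℂ)) : BondL2K ℂ 3 (periodsT3 F K) c₀ W₂ →ₗ[ℂ] BondL2K ℂ 3 (periodsT3 F K) c₀ W₂ :=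
  laplaceALatticeK (((eta F n K : ℝ) : ℂ)⁻¹) (adBg F K U₀) (adBgInv F K U₀) (Δx U₀) (Rc F n K h c₀ cB U₀) (Qkc F n K h c₀ cB U₀) a

/-- **THE CLASS ON WHICH THE COMB LETTERS ARE PRINT'S**: `Δ_a(U₀)` positive definite ([B9] Thm 3.11, N06 — displayed, not proved) and `Q_k(U₀)` onto ((3.19)).
[cite: Balaban1985BackgroundPropagators, Thm 3.11 p.416, (3.19) p.393] -/
structure PosOntoC (U₀ : GaugeField (F.P K) 0 (Matrix.specialUnitaryGroup (Fin 2) ℂ)) : Prop where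
  /-- `Δ_a(U₀)` is positive definite. -/
  pos : ∀ x : BondL2K ℂ 3 (periodsT3 F K) c₀ W₂, x ≠ 0 → 0 < RCLike.re ⟪x, laplaceAc F n K h c₀ cB a Δx U₀ x⟫_ℂ
  /-- `Q_k(U₀)` is onto. -/
  onto : Function.Surjective (Qkc F n K h c₀ cB U₀)

open Classical in
/-- **`G(U₀) = Δ_a(U₀)⁻¹` AS A TOTAL LETTER FOR THE COMB AVERAGING**: lit-balaban's `G1LatticeK` on the class `PosOntoC`, `0` off it. [cite: Balaban1985BackgroundPropagators, (3.27) p.395, (3.122) p.420] -/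
def GTc (U₀ : GaugeField (F.P K) 0 (Matrix.specialUnitaryGroup (Fin 2) ℂ)) : BondL2K ℂ 3 (periodsT3 F K) c₀ W₂ →ₗ[ℂ] BondL2K ℂ 3 (periodsT3 F K) c₀ W₂ :=
  if hp : PosOntoC F n K h c₀ cB a Δx U₀ then G1LatticeK hp.pos else 0

variable {F n K h c₀ cB a Δx}

omit [Fact (0 < c₀)] [Fact (0 < cB)] in
/-- Unfolding `Qkc = η • QL2c` on `toL2 A`: `Qkc U₀ (toL2 A) = η • toL2B (QTw U₀ A)`. [cite: Balaban1985Variational, (44) p.285] -/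
theorem Qkc_toL2 (U₀ : GaugeField (F.P K) 0 (Matrix.specialUnitaryGroup (Fin 2) ℂ)) (A : PBond (F.P K) 0 → Matrix (Fin 2) (Fin 2) ℂ) :
    Qkc F n K h c₀ cB U₀ (toL2 F K c₀ A) = (((eta F n K : ℝ) : ℂ)) • toL2B F n cB (QTw F n K h U₀ A) := by
  rw [Qkc, LinearMap.smul_apply, QL2c_toL2]

/-- ★ **THE COMB `Δ_a(U₀)` IS lit-balaban's `laplaceAK`** at `Δ := Δx(U₀)`, `D := DL2`, `R := Rc(U₀)`, `D* := DstarL2`, `Q := Qkc(U₀)`, `Q* := Qkc†`, weight `a` — by `rfl` (the shape of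
✓`Prop7HessOnPrintSlice.laplaceA_eq_laplaceAK`, so the slots doors over `laplaceAK` instantiate at `(Rr, Qc) := (Rc, Qkc)`). [cite: Balaban1985BackgroundPropagators, (3.26) p.395; Balaban1985Variational, (110) p.294] -/
theorem laplaceAc_eq_laplaceAK (U₀ : GaugeField (F.P K) 0 (Matrix.specialUnitaryGroup (Fin 2) ℂ)) :
    laplaceAc F n K h c₀ cB a Δx U₀
      = laplaceAK (Δx U₀) (DL2 F n K c₀ U₀) (Rc F n K h c₀ cB U₀) (DstarL2 F n K c₀ U₀) (Qkc F n K h c₀ cB U₀)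
          (LinearMap.adjoint (Qkc F n K h c₀ cB U₀)) ((a : ℝ) : ℂ) := rfl

/-- On the class, `G` IS lit-balaban's `G1LatticeK`. [cite: Balaban1985BackgroundPropagators, (3.27) p.395] -/
theorem GTc_of_pos {U₀ : GaugeField (F.P K) 0 (Matrix.specialUnitaryGroup (Fin 2) ℂ)} (hp : PosOntoC F n K h c₀ cB a Δx U₀) :
    GTc F n K h c₀ cB a Δx U₀ = G1LatticeK hp.pos := dif_pos hp

/-- Off the class, `G` is the junk value `0`. [folklore] -/
theorem GTc_of_not {U₀ : GaugeField (F.P K) 0 (Matrix.specialUnitaryGroup (Fin 2) ℂ)} (hp : ¬ PosOntoC F n K h c₀ cB a Δx U₀) : GTc F n K h c₀ cB a Δx U₀ = 0 := dif_neg hp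

/-- **`Δ_a G = 1` ON THE CLASS.** [cite: Balaban1985BackgroundPropagators, (3.27) p.395] -/
theorem laplaceAc_GTc {U₀ : GaugeField (F.P K) 0 (Matrix.specialUnitaryGroup (Fin 2) ℂ)} (hp : PosOntoC F n K h c₀ cB a Δx U₀) (x : BondL2K ℂ 3 (periodsT3 F K) c₀ W₂) :
    laplaceAc F n K h c₀ cB a Δx U₀ (GTc F n K h c₀ cB a Δx U₀ x) = x := by
  rw [GTc_of_pos hp]
  exact laplaceALatticeK_G1LatticeK hp.pos x

end Propagators

/-! ## §4 (v1.1, ★p1 g17 WORD 25 (b)) The comb `Δ_a` with the gauge projector as a PARAMETER `Rr` — so the slot of record `Rr := RcombL2` (w1's print-literal `Q′_k` projector) and the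
intrinsic `Rc` are both instances -/

section ProjectorSlot

variable (F : T3Family) (n K : ℕ) (h : n ≤ K) (c₀ cB a : ℝ) [Fact (0 < c₀)] [Fact (0 < cB)]
  (Δx : GaugeField (F.P K) 0 (Matrix.specialUnitaryGroup (Fin 2) ℂ) → (BondL2K ℂ 3 (periodsT3 F K) c₀ W₂ →ₗ[ℂ] BondL2K ℂ 3 (periodsT3 F K) c₀ W₂))

/-- **`Δ_a(U₀) = Δx(U₀) + D_{U₀} Rr D*_{U₀} + Q*aQ` WITH THE GAUGE PROJECTOR `Rr` A PARAMETER** (the comb averaging `Qkc` fixed): ★p1 g17 WORD 25 (b) — instantiate at `Rr := Rc … U₀`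
(intrinsic, below `laplaceAc_eq_laplaceAcR`) or at w1's print-literal `RcombL2 … U₀` (the slot of record). [cite: Balaban1985BackgroundPropagators, (3.26) p.395, (3.21) p.394] -/
def laplaceAcR (U₀ : GaugeField (F.P K) 0 (Matrix.specialUnitaryGroup (Fin 2) ℂ)) (Rr : SiteL2K ℂ 3 (periodsT3 F K) c₀ W₂ →ₗ[ℂ] SiteL2K ℂ 3 (periodsT3 F K) c₀ W₂) :
    BondL2K ℂ 3 (periodsT3 F K) c₀ W₂ →ₗ[ℂ] BondL2K ℂ 3 (periodsT3 F K) c₀ W₂ :=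
  laplaceALatticeK (((eta F n K : ℝ) : ℂ)⁻¹) (adBg F K U₀) (adBgInv F K U₀) (Δx U₀) Rr (Qkc F n K h c₀ cB U₀) a

variable {F n K h c₀ cB a Δx}

/-- ★ **`laplaceAcR … U₀ Rr` IS lit-balaban's `laplaceAK`** at `Δ := Δx(U₀)`, `D := DL2`, `R := Rr`, `D* := DstarL2`, `Q := Qkc(U₀)`, `Q* := Qkc†`, weight `a` — by `rfl`.
[cite: Balaban1985BackgroundPropagators, (3.26) p.395; Balaban1985Variational, (110) p.294] -/
theorem laplaceAcR_eq_laplaceAK (U₀ : GaugeField (F.P K) 0 (Matrix.specialUnitaryGroup (Fin 2) ℂ)) (Rr : SiteL2K ℂ 3 (periodsT3 F K) c₀ W₂ →ₗ[ℂ] SiteL2K ℂ 3 (periodsT3 F K) c₀ W₂) :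
    laplaceAcR F n K h c₀ cB a Δx U₀ Rr
      = laplaceAK (Δx U₀) (DL2 F n K c₀ U₀) Rr (DstarL2 F n K c₀ U₀) (Qkc F n K h c₀ cB U₀) (LinearMap.adjoint (Qkc F n K h c₀ cB U₀)) ((a : ℝ) : ℂ) := rfl

/-- The intrinsic instance: `laplaceAc … U₀ = laplaceAcR … U₀ (Rc … U₀)`, by `rfl`. [cite: Balaban1985BackgroundPropagators, (3.26) p.395] -/
theorem laplaceAc_eq_laplaceAcR (U₀ : GaugeField (F.P K) 0 (Matrix.specialUnitaryGroup (Fin 2) ℂ)) :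
    laplaceAc F n K h c₀ cB a Δx U₀ = laplaceAcR F n K h c₀ cB a Δx U₀ (Rc F n K h c₀ cB U₀) := rfl

end ProjectorSlot

end Summit.QuantumFields.YangMills.Theorems.Prop7SectET3CombLetters

end
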